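import Literature.Probability.Distributions.ConvexPotentialTails
import Literature.NumberTheory.LFunctions.XiMoments
import Literature.NumberTheory.LFunctions.DeBruijnPhiLogConcave
import HarnessLib

/-!
# The tilted measures `u^k Φ(u) du`: a window lower bound for the normaliser `M_k`

`Literature/NumberTheory/LFunctions/`. Companion of `XiTiltedPotential.lean` / `XiTiltedSecondMoment.lean`
(potential `W_k = −(k log u + log Φ)`, `e^{−W_k} = u^kΦ`; the calculus facts are re-proved here as
private helpers so that this file depends on tree files only). If `a > 0` is a critical point of `W_k` and
`W_k″ ≤ Λ` on a window `[a − s, a + s]` (`0 < s < a`), then by the second-order Taylor bound at `a`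
(`W_k(u) − W_k(a) ≤ Λ(u − a)²/2`, the tree's `sub_le_mul_sq_div_two_of_deriv2_le` of
`ConvexPotentialTails.lean`), `M_k = xiMoment k = ∫₀^∞ u^kΦ ≥ 2s · a^kΦ(a) · e^{−Λs²/2}`
(`xiMoment_ge_window`). This is the normaliser input of the one-sided tail estimates in the
Jensen track's tail lemma (eng-3, LADDER-BL.md (4.3)–(4.4)); the Gaussian-integral refinement
`(2/√Λ)(√(π/2) − e^{−X²/2}/X)` of the printed argument is not needed there (the normaliser only
multiplies terms of size `e^{−x/2}`), so the two-line window bound is what is formalised. The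
ceiling `Λ` (an upper envelope of `k/u² − (log Φ)″` near `a`) is a hypothesis. Theorems only.

References: Griffin–Ono–Rolen–Zagier, PNAS 116 (2019), Thm 7 / §5.1 [GORZPNAS2019].
-/

noncomputable section

open MeasureTheory Set Filter
open scoped Topology

namespace Literature.NumberTheory.LFunctions

open Literature.Probability.Distributions

/-! ### The normaliser: a window lower bound for `M_k` at the mode -/

/-- `e^{−W_k(u)} = Φ(u) u^k` for `u > 0` (private helper). [folklore] -/
private theorem exp_neg_xiPotential' (k : ℕ) {u : ℝ} (hu : 0 < u) :
    Real.exp (-(-((k : ℝ) * Real.log u + Real.log (deBruijnPhi u)))) = deBruijnPhi u * u ^ k := by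
  rw [neg_neg, Real.exp_add, Real.exp_nat_mul, Real.exp_log hu,
    Real.exp_log (deBruijnPhi_pos_holds u)]
  ring

/-- `W_k′(u) = −(k/u + Φ′(u)/Φ(u))` on `(0, ∞)` (private helper). [folklore] -/
private theorem hasDerivAt_xiPotential' (k : ℕ) {u : ℝ} (hu : 0 < u) :
    HasDerivAt (fun t => -((k : ℝ) * Real.log t + Real.log (deBruijnPhi t)))
      (-((k : ℝ) / u + deBruijnPhiDeriv u / deBruijnPhi u)) u := by
  have h1 : HasDerivAt (fun t => (k : ℝ) * Real.log t) ((k : ℝ) * u⁻¹) u :=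
    (Real.hasDerivAt_log hu.ne').const_mul _
  have h2 := hasDerivAt_log_deBruijnPhi u
  have h : HasDerivAt (fun t => -((k : ℝ) * Real.log t + Real.log (deBruijnPhi t)))
      (-((k : ℝ) * u⁻¹ + deBruijnPhiDeriv u / deBruijnPhi u)) u := (h1.add h2).neg
  exact h.congr_deriv (by simp only [div_eq_mul_inv])

/-- `W_k″(u) = k/u² + (Φ′² − ΦΦ″)/Φ²` on `(0, ∞)` (private helper). [folklore] -/
private theorem hasDerivAt_xiPotentialDeriv' (k : ℕ) {u : ℝ} (hu : 0 < u) :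
    HasDerivAt (fun t => -((k : ℝ) / t + deBruijnPhiDeriv t / deBruijnPhi t))
      ((k : ℝ) / u ^ 2 +
        (deBruijnPhiDeriv u ^ 2 - deBruijnPhi u * deBruijnPhiDeriv₂ u) / deBruijnPhi u ^ 2) u := by
  have h1 : HasDerivAt (fun t => (k : ℝ) / t) ((0 * u - (k : ℝ) * 1) / u ^ 2) u :=
    (hasDerivAt_const u (k : ℝ)).div (hasDerivAt_id' u) hu.ne'
  have h2 := hasDerivAt_deriv_log_deBruijnPhi u
  have h : HasDerivAt (fun t => -((k : ℝ) / t + deBruijnPhiDeriv t / deBruijnPhi t))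
      (-((0 * u - (k : ℝ) * 1) / u ^ 2 +
        (deBruijnPhiDeriv₂ u * deBruijnPhi u - deBruijnPhiDeriv u * deBruijnPhiDeriv u) /
          deBruijnPhi u ^ 2)) u := (h1.add h2).neg
  refine h.congr_deriv ?_
  have hΦ := (deBruijnPhi_pos_holds u).ne'
  have hu' := hu.ne'
  field_simp
  ring

/-- `W_k″ > 0` on `(0, ∞)` (private helper; from `deBruijnPhi_logConcave_quantitative`). [folklore] -/
private theorem xiPotentialDeriv₂_pos' (k : ℕ) {u : ℝ} (hu : 0 < u) :
    0 < (k : ℝ) / u ^ 2 +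
        (deBruijnPhiDeriv u ^ 2 - deBruijnPhi u * deBruijnPhiDeriv₂ u) / deBruijnPhi u ^ 2 := by
  have h := deBruijnPhi_logConcave_quantitative u
  have hΦ := pow_pos (deBruijnPhi_pos_holds u) 2
  have h1 : 0 < (deBruijnPhiDeriv u ^ 2 - deBruijnPhi u * deBruijnPhiDeriv₂ u) / deBruijnPhi u ^ 2 :=
    div_pos (lt_of_le_of_lt (by positivity) h) hΦ
  have h2 : 0 ≤ (k : ℝ) / u ^ 2 := by positivity
  linarith

/-- **Window lower bound for the mass at the mode**: if `a > 0` is a critical point of `W_k` and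
`W_k″ ≤ Λ` on `[a − s, a + s]` (`0 < s < a`), then `W_k(u) − W_k(a) ≤ Λs²/2` there, hence
`M_k = ∫₀^∞ Φu^k ≥ 2s · Φ(a)a^k · e^{−Λs²/2}` (the normaliser bound of the tail lemma; a
Gaussian-integral refinement is unnecessary for its use). [cite: GORZPNAS2019, Thm 7 and §5.1] -/
theorem xiMoment_ge_window (k : ℕ) {a s Λ : ℝ} (hs : 0 < s) (hsa : s < a)
    (hmode : (k : ℝ) / a + deBruijnPhiDeriv a / deBruijnPhi a = 0)
    (hceil : ∀ u ∈ Icc (a - s) (a + s), (k : ℝ) / u ^ 2 +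
      (deBruijnPhiDeriv u ^ 2 - deBruijnPhi u * deBruijnPhiDeriv₂ u) / deBruijnPhi u ^ 2 ≤ Λ) :
    2 * s * (deBruijnPhi a * a ^ k * Real.exp (-(Λ * s ^ 2 / 2))) ≤ xiMoment k := by
  set g : ℝ → ℝ := fun t => -((k : ℝ) * Real.log t + Real.log (deBruijnPhi t)) with hg
  have hI : Icc (a - s) (a + s) ⊆ Ioi (0 : ℝ) := fun u hu => lt_of_lt_of_le (by linarith) hu.1
  have ha : 0 < a := by linarith
  have hga : -((k : ℝ) / a + deBruijnPhiDeriv a / deBruijnPhi a) = 0 := by rw [hmode, neg_zero]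
  have ha_mem : a ∈ Icc (a - s) (a + s) := ⟨by linarith, by linarith⟩
  have key : ∀ u ∈ Icc (a - s) (a + s), g u - g a ≤ Λ * (u - a) ^ 2 / 2 := fun u hu =>
    sub_le_mul_sq_div_two_of_deriv2_le (g := g) ha_mem
      (fun x hx => hasDerivAt_xiPotential' k (hI hx))
      (fun x hx => hasDerivAt_xiPotentialDeriv' k (hI hx)) hceil hga hu
  have hΛ : 0 ≤ Λ :=
    le_trans (xiPotentialDeriv₂_pos' k ha).le (hceil a ha_mem)
  -- pointwise lower bound on the window
  have hpt : ∀ u ∈ Icc (a - s) (a + s),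
      deBruijnPhi a * a ^ k * Real.exp (-(Λ * s ^ 2 / 2)) ≤ deBruijnPhi u * u ^ k := by
    intro u hu
    have h1 := key u hu
    have h2 : (u - a) ^ 2 ≤ s ^ 2 := by
      rw [← sq_abs (u - a)]
      exact pow_le_pow_left₀ (abs_nonneg _) (abs_le.2 ⟨by linarith [hu.1], by linarith [hu.2]⟩) 2
    have h3 : g u ≤ g a + Λ * s ^ 2 / 2 := by nlinarith
    rw [← exp_neg_xiPotential' k (hI hu), ← exp_neg_xiPotential' k ha, ← Real.exp_add]
    exact Real.exp_le_exp.2 (by simp only [hg] at h3 ⊢; linarith)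
  have hvol : volume.real (Icc (a - s) (a + s)) = 2 * s := by
    rw [Real.volume_real_Icc_of_le (by linarith)]; ring
  calc 2 * s * (deBruijnPhi a * a ^ k * Real.exp (-(Λ * s ^ 2 / 2)))
      = ∫ _ in Icc (a - s) (a + s), deBruijnPhi a * a ^ k * Real.exp (-(Λ * s ^ 2 / 2)) := by
        rw [setIntegral_const, hvol, smul_eq_mul]
    _ ≤ ∫ u in Icc (a - s) (a + s), deBruijnPhi u * u ^ k :=
        setIntegral_mono_on (integrableOn_const (by rw [Real.volume_Icc]; exact ENNReal.ofReal_ne_top))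
          ((integrableOn_deBruijnPhi_mul_pow k).mono_set hI) measurableSet_Icc hpt
    _ ≤ xiMoment k := by
        rw [xiMoment]
        exact setIntegral_mono_set (integrableOn_deBruijnPhi_mul_pow k)
          ((ae_restrict_iff' measurableSet_Ioi).2 (ae_of_all _ fun u hu =>
            (mul_pos (deBruijnPhi_pos_holds u) (pow_pos hu k)).le))
          hI.eventuallyLE

end Literature.NumberTheory.LFunctions
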